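import Summits.BirchSwinnertonDyer.Rank1Residual.X2.GreenbergSelmerCountLe
import Summits.BirchSwinnertonDyer.Rank1Residual.X2.GreenbergVatsalAnalyticTransfer
import HarnessLib

/-!
# GV at an odd multiplicative Eisenstein prime: the analytic transfer, UPPER HALF —
# `ord_T(b mod p) ≤ ord_T(T^e · f_E mod p)` from the count INEQUALITY (no T-GV23L, no A137′) —
# cell `b2b-bsdres`, unit `b2b-bsdres-eisenstein-p2`, gen 30 (F7b)

HONEST FRAMING (run/shared/lean/b2b/bsd-rank1-residual/, verbatim in every file): the goal of the
cell is to DELETE the COMBINATION-SHAPED residual classes of the Birch–Swinnerton-Dyer formula for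
ALL analytic-rank `≤ 1` elliptic curves over `ℚ` — "full BSD formula for every rank `≤ 1` curve in
class `C`" assembled STRICTLY from published theorems — so that the rank-`≤ 1` remainder becomes
exactly the CONSTRUCTION-SHAPED classes, which are TYPED (missing-input `Prop`s), NOT attempted.
This is not "finishing BSD". Research route; NO CLAIM BEYOND STATED CLASSES; nothing here changes a
label. Theorems only; no definition, no named fact, no `sorry`.

WHAT. Gen 17's `GreenbergVatsalAnalyticTransfer.unitContent_and_order_eq_of_card_eq_of_{split,not_split}`
turned the analytic shape (C) `p^{ord_T(b·∏𝒫 mod p)} = #H¹(ℚ_Σ/ℚ_∞, Φ₀) · #S^{Σ₀}_{E[p]/Φ₀}(ℚ_∞)`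
and the algebraic EQUALITY `#H¹(Φ₀)·#S^{Σ₀}_{ψ} = p^{λ(X)+Σδ+e}` (A133 + A137) into the clause
`ord_T(b mod p) = ord_T(T^e f_E mod p)`. With gen 30's kernel INEQUALITY
(`GreenbergSelmerCountLe.natCard_line_mul_quotSelmer_le_of_*`: `≤ p^{λ(X)+Σδ+e}` for bad `Σ₀`, from
A40/A41/A135 only) the same cancellation gives the UPPER HALF:

* `unitContent_and_order_le_of_order_nonPrimitive_le` — the cancellation (C)+(D) with `≤`;
* **`unitContent_and_order_le_of_card_eq_of_split`** / **`…_of_not_split`** — `b` has unit content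
  and `ord_T(b mod p) ≤ ord_T(T·f_E mod p)` resp. `≤ ord_T(f_E mod p)`.

The reverse inequality is Wuthrich's divisibility `char X ∣ (L_p)` (A33): see the sequel
`GreenbergVatsalCaseOneLe`.

References: [GreenbergVatsal2000] §1 (8)–(9), Thm. (1.5); §2 (16), pp. 28–30; §3 Thm. (3.11),
(26)–(28); HOME/b2b-bsdres-eisenstein-p2/X2-GAP.md §35.
-/

set_option autoImplicit false

noncomputable section

open scoped Classical AddSubgroup

open PowerSeries NumberField IsDedekindDomain Field WeierstrassCurve
  Literature.NumberTheory.EllipticCurves Literature.NumberTheory.EllipticCurves.GreenbergVatsal2000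
  Literature.NumberTheory.EllipticCurves.Rank1Residual
  Summit.BirchSwinnertonDyer.Rank1Residual.X2.EulerFactorAlgebra
  Summit.BirchSwinnertonDyer.Rank1Residual.X2.EulerFactorInvariants
  Summit.BirchSwinnertonDyer.Rank1Residual.X2.GreenbergVatsalAnalyticTransferCore
  Summit.BirchSwinnertonDyer.Rank1Residual.X2.GreenbergSelmerCountLe

namespace Summit.BirchSwinnertonDyer.Rank1Residual.X2.GreenbergVatsalAnalyticTransferLe

/-! ## §1. The cancellation with `≤` -/

section Core

variable (W : WeierstrassCurve ℚ) {p : ℕ} [hp : Fact p.Prime] {κ : ZpExtension ℚ p}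
  {γ : absoluteGaloisGroup ℚ} (S₀ : Finset (HeightOneSpectrum (𝓞 ℚ)))

/-- **The cancellation (C)+(D) ⟹ clause, upper half.** If `b^{Σ₀} = b · ∏_{ℓ∈Σ₀} 𝒫_ℓ` has unit
content and `T`-order `≤ λ(X) + Σ_{ℓ∈Σ₀} δ_E^{(ℓ)} + e`, where `X` (f.g. torsion, `μ = 0`) has
`char X = (f_E)`, then `b` has unit content and `ord_T(b mod p) ≤ ord_T(f_E mod p) + e`: display (9)
(`ord_T(b^{Σ₀} mod p) = ord_T(b mod p) + Σδ`) removes `Σδ`, the dictionary turns `λ(X)` into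
`ord_T(f_E mod p)`. [cite: GreenbergVatsal2000, §1 (8)–(9), Thm. (1.5)] -/
theorem unitContent_and_order_le_of_order_nonPrimitive_le (hp2 : p ≠ 2)
    (hS₀ : ∀ v ∈ S₀, Rat.HeightOneSpectrum.natGenerator v ≠ p)
    (D : W.SelmerDualData κ γ) [Module.Finite (IwasawaAlgebra p) D.X] (hX : D.IsTorsion)
    (hμ : D.mu = 0) {fE : IwasawaAlgebra p} (hchar : D.charIdeal = Ideal.span {fE})
    {b : IwasawaAlgebra p} (e : ℕ) (hbu : HasUnitContent (b * eulerFactorProduct W p S₀))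
    (hord : (PowerSeries.map (PadicInt.toZMod (p := p)) (b * eulerFactorProduct W p S₀)).order.toNat ≤
      lambdaInvariant p D.X + ∑ v ∈ S₀, delta W p v + e) :
    HasUnitContent b ∧
      (PowerSeries.map (PadicInt.toZMod (p := p)) b).order ≤
        (PowerSeries.map (PadicInt.toZMod (p := p)) fE).order + e := by
  have hbu' : HasUnitContent b := ((hasUnitContent_mul_iff _ _).mp hbu).1
  refine ⟨hbu', ?_⟩
  have hfin : (PowerSeries.map (PadicInt.toZMod (p := p)) b).order ≠ ⊤ := by
    rw [Ne, PowerSeries.order_eq_top]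
    exact (hasUnitContent_iff_map_toZMod_ne_zero b).mp hbu'
  obtain ⟨n, hn⟩ := ENat.ne_top_iff_exists.mp hfin
  rw [order_map_toZMod_mul_eulerFactorProduct W S₀ hp2 hS₀ b, ← hn] at hord
  have h' : n + ∑ v ∈ S₀, delta W p v ≤ lambdaInvariant p D.X + ∑ v ∈ S₀, delta W p v + e := by
    have h := hord
    rw [← ENat.coe_add, ENat.toNat_coe] at h
    exact h
  rw [← natCast_lambdaInvariant_eq_order_map_toZMod D hX hμ hchar, ← hn]
  have hn' : n ≤ lambdaInvariant p D.X + e := by omega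
  exact_mod_cast hn'

end Core

/-! ## §2. The clause, upper half, from the displayed analytic hypothesis -/

section Assembly

variable (W : WeierstrassCurve ℚ) [W.IsGloballyMinimal] [W.IsElliptic] (p : ℕ) [hp : Fact p.Prime]
  (κ : ZpExtension ℚ p) {γ : absoluteGaloisGroup ℚ} (S₀ : Finset (HeightOneSpectrum (𝓞 ℚ)))
  {Φ₀ : AddSubgroup (W.geomTorsion (p : ℤ))} (hΦ : IsRationalLine W p Φ₀)

/-- **SPLIT odd `p ‖ N`, GV case 1 — the clause, UPPER HALF.** Inputs: A40/A41 (`hT`, `hT'`), A135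
(`hB`), `κ` cyclotomic with topological generator `γ`, `Σ₀ ∌ p` finite, BAD, containing every bad
place `≠ p`, a dual datum `D` of `Sel_{p^∞}(E/ℚ_∞)` with `X` f.g. torsion and `μ(X) = 0`, the rational
line `Φ₀` ramified at `p` and even, the lifting property `hlift`, and the analytic statement (C) for
`b · ∏_{ℓ∈Σ₀} 𝒫_ℓ`: unit content and `p^{ord_T} = #H¹(ℚ_Σ/ℚ_∞, Φ₀) · #S^{Σ₀}_{E[p]/Φ₀}(ℚ_∞)`.
Output: `b` has unit content and `ord_T(b mod p) ≤ ord_T(T · f_E mod p)`. NOT used: A133, A137.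
[cite: GreenbergVatsal2000, §2 (16), pp. 28–30; §3 Thm. (3.11), (28), p. 43] -/
theorem unitContent_and_order_le_of_card_eq_of_split
    (hT : Silverman1994_thmV53_tateUniformisation.{0})
    (hT' : Silverman1994_thmV53_corV54_tateUniformisation.{0})
    (hB : datumSelmer_divisible_of_finite_torsionBy)
    (hκ : κ.IsCyclotomic) (hγ : κ.IsTopGenerator γ) (hp2 : p ≠ 2)
    (hsplit : W.HasSplitMultiplicativeReductionAtPrime p)
    (hS₀ : ∀ v ∈ S₀, ((p : ℕ) : 𝓞 ℚ) ∉ v.asIdeal) (hbad : ∀ v ∈ S₀, ¬ W.HasGoodReductionAt v)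
    (hS : ∀ v : HeightOneSpectrum (𝓞 ℚ), v ∉ S₀ → ((p : ℕ) : 𝓞 ℚ) ∉ v.asIdeal →
      W.HasGoodReductionAt v)
    (D : W.SelmerDualData κ γ) [Module.Finite (IwasawaAlgebra p) D.X] (hX : D.IsTorsion)
    (hμ : D.mu = 0) (hram : ¬ LineUnramifiedAt W p Φ₀) (heven : LineEven W p Φ₀)
    (hlift : ∀ s ∈ ResidualDevissageSelmer.quotSelmer κ.kerSubgroup
        (ResidualDevissageLine.lineSub Φ₀ hΦ).Quot p (↑S₀ : Set (HeightOneSpectrum (𝓞 ℚ))),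
      ∃ x ∈ GreenbergVatsal2000.unramifiedOutside κ.kerSubgroup
          ↥((↥(W.geomPrimaryTorsion p))[(p : ℤ)]) p (↑S₀ : Set (HeightOneSpectrum (𝓞 ℚ))),
        ResidualDevissageSelmer.subH1 κ.kerSubgroup (ResidualDevissageLine.lineSub Φ₀ hΦ).proj
          (ResidualDevissageLine.lineSub Φ₀ hΦ).proj_smul x = s)
    {b : IwasawaAlgebra p}
    (hC : HasUnitContent (b * eulerFactorProduct W p S₀) ∧
      p ^ (PowerSeries.map (PadicInt.toZMod (p := p)) (b * eulerFactorProduct W p S₀)).order.toNat =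
        Nat.card (GreenbergVatsal2000.unramifiedOutside κ.kerSubgroup
            (ResidualDevissageLine.lineSub Φ₀ hΦ).Sub p (↑S₀ : Set (HeightOneSpectrum (𝓞 ℚ)))) *
          Nat.card (ResidualDevissageSelmer.quotSelmer κ.kerSubgroup
            (ResidualDevissageLine.lineSub Φ₀ hΦ).Quot p (↑S₀ : Set (HeightOneSpectrum (𝓞 ℚ)))))
    {fE : IwasawaAlgebra p} (hchar : D.charIdeal = Ideal.span {fE}) :
    HasUnitContent b ∧
      (PowerSeries.map (PadicInt.toZMod (p := p)) b).order ≤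
        (PowerSeries.map (PadicInt.toZMod (p := p)) (PowerSeries.X * fE)).order := by
  have hS₀' : ∀ v ∈ S₀, Rat.HeightOneSpectrum.natGenerator v ≠ p :=
    fun v hv => natGenerator_ne_of_natCast_not_mem v (hS₀ v hv)
  obtain ⟨hbu, hC⟩ := hC
  have hA' := natCard_line_mul_quotSelmer_le_of_split W p κ S₀ hΦ hT hT' hB hκ hγ hp2 hsplit hS₀ hbad
    hS D hX hμ hram heven hlift
  rw [← hC] at hA'
  have hexp := (pow_le_pow_iff_right₀ hp.out.one_lt).1 hA'
  rw [order_map_toZMod_X_mul]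
  exact unitContent_and_order_le_of_order_nonPrimitive_le W S₀ hp2 hS₀' D hX hμ hchar 1 hbu hexp

/-- **NON-SPLIT odd `p ‖ N`, GV case 1 — the clause, UPPER HALF** (no trivial zero:
`ord_T(b mod p) ≤ ord_T(f_E mod p)`; inputs as in the split case). NOT used: A133.
[cite: GreenbergVatsal2000, §2 (16), pp. 28–30; §3 Thm. (3.11), (28), p. 43] -/
theorem unitContent_and_order_le_of_card_eq_of_not_split
    (hT : Silverman1994_thmV53_tateUniformisation.{0})
    (hT' : Silverman1994_thmV53_corV54_tateUniformisation.{0})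
    (hB : datumSelmer_divisible_of_finite_torsionBy)
    (hκ : κ.IsCyclotomic) (hγ : κ.IsTopGenerator γ) (hp2 : p ≠ 2)
    (hmult : W.HasMultiplicativeReductionAtPrime p) (hns : ¬ W.HasSplitMultiplicativeReductionAtPrime p)
    (hS₀ : ∀ v ∈ S₀, ((p : ℕ) : 𝓞 ℚ) ∉ v.asIdeal) (hbad : ∀ v ∈ S₀, ¬ W.HasGoodReductionAt v)
    (hS : ∀ v : HeightOneSpectrum (𝓞 ℚ), v ∉ S₀ → ((p : ℕ) : 𝓞 ℚ) ∉ v.asIdeal →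
      W.HasGoodReductionAt v)
    (D : W.SelmerDualData κ γ) [Module.Finite (IwasawaAlgebra p) D.X] (hX : D.IsTorsion)
    (hμ : D.mu = 0) (hram : ¬ LineUnramifiedAt W p Φ₀) (heven : LineEven W p Φ₀)
    (hlift : ∀ s ∈ ResidualDevissageSelmer.quotSelmer κ.kerSubgroup
        (ResidualDevissageLine.lineSub Φ₀ hΦ).Quot p (↑S₀ : Set (HeightOneSpectrum (𝓞 ℚ))),
      ∃ x ∈ GreenbergVatsal2000.unramifiedOutside κ.kerSubgroup
          ↥((↥(W.geomPrimaryTorsion p))[(p : ℤ)]) p (↑S₀ : Set (HeightOneSpectrum (𝓞 ℚ))),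
        ResidualDevissageSelmer.subH1 κ.kerSubgroup (ResidualDevissageLine.lineSub Φ₀ hΦ).proj
          (ResidualDevissageLine.lineSub Φ₀ hΦ).proj_smul x = s)
    {b : IwasawaAlgebra p}
    (hC : HasUnitContent (b * eulerFactorProduct W p S₀) ∧
      p ^ (PowerSeries.map (PadicInt.toZMod (p := p)) (b * eulerFactorProduct W p S₀)).order.toNat =
        Nat.card (GreenbergVatsal2000.unramifiedOutside κ.kerSubgroup
            (ResidualDevissageLine.lineSub Φ₀ hΦ).Sub p (↑S₀ : Set (HeightOneSpectrum (𝓞 ℚ)))) *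
          Nat.card (ResidualDevissageSelmer.quotSelmer κ.kerSubgroup
            (ResidualDevissageLine.lineSub Φ₀ hΦ).Quot p (↑S₀ : Set (HeightOneSpectrum (𝓞 ℚ)))))
    {fE : IwasawaAlgebra p} (hchar : D.charIdeal = Ideal.span {fE}) :
    HasUnitContent b ∧
      (PowerSeries.map (PadicInt.toZMod (p := p)) b).order ≤
        (PowerSeries.map (PadicInt.toZMod (p := p)) fE).order := by
  have hS₀' : ∀ v ∈ S₀, Rat.HeightOneSpectrum.natGenerator v ≠ p :=
    fun v hv => natGenerator_ne_of_natCast_not_mem v (hS₀ v hv)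
  obtain ⟨hbu, hC⟩ := hC
  have hA' := natCard_line_mul_quotSelmer_le_of_not_split W p κ S₀ hΦ hT hT' hB hκ hγ hp2 hmult hns
    hS₀ hbad hS D hX hμ hram heven hlift
  rw [← hC] at hA'
  have hexp : (PowerSeries.map (PadicInt.toZMod (p := p)) (b * eulerFactorProduct W p S₀)).order.toNat ≤
      lambdaInvariant p D.X + ∑ v ∈ S₀, delta W p v + 0 := by
    rw [add_zero]; exact (pow_le_pow_iff_right₀ hp.out.one_lt).1 hA'
  have h := unitContent_and_order_le_of_order_nonPrimitive_le W S₀ hp2 hS₀' D hX hμ hchar 0 hbu hexp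
  rwa [Nat.cast_zero, add_zero] at h

end Assembly

end Summit.BirchSwinnertonDyer.Rank1Residual.X2.GreenbergVatsalAnalyticTransferLe

end
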